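import Summits.HodgeConjecture.HodgeConjecture.Theorems.Ring2HypothesesDescentAbsoluteExteriorLefschetzAction
import Summits.HodgeConjecture.HodgeConjecture.Theorems.Ring2HypothesesDescentAbsoluteExteriorPowers
import HarnessLib

/-!
# Ring 2 — hypotheses layer, descent axis: MILNE'S TANNAKA-FREE SPECIAL LEFSCHETZ GROUP ACTS THROUGH `H¹`:
# `g_k = ⋀ᵏ(g₁)` for `g ∈ S(A)`, `g ↦ g₁` is a BIJECTION `S(A) → S(A)(ℂ) = U(C(A) ⊗ ℂ, †)` (Milne 1999 Thm. 4.4 in full on the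
# carriers), the Künneth family of `g` is `⋀•(g₁^{⊕(a+1)})`, and `S(A^{r+1}) = S(A)` diagonally (Cor. 4.7) for the groups themselves

HONEST FRAMING (page 1, verbatim the cell's standing line): **research route conditional on HC_CM; not a
corollary; Q11.4-sentence-2 already refuted in dim ≥ 3.** Nothing in this file proves a case of the Hodge conjecture;
nothing discharges the binder of record b06 `Ring2.Hypotheses.AbsoluteHodgeImpliesAlgebraicAV` («absolute Hodge classes
on complex abelian varieties are algebraic», `Ring2HypothesesDescent.lean` :73; OPEN); the binder table's numbers do not
move. `HC_CM` (`Theses.RankFourFaces.CMAbelianHodge`), `HC_AV`, row b06 and every hypothesis of the cell are ABSENT from this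
file. Hodge ladder STAGE 3, `BINDER-OWNERS.md` row **b06**, seat `ring2-b06` (gen 85). Third file of «`S(A)` acts through `H¹`»
(companions `…ExteriorLefschetzGraphs`, `…ExteriorLefschetzAction`), closing what gen 84 (`…ExteriorLefschetz`: «`S(A^r) = S(A)`
diagonally, Tannaka-free») and this gen's `Milne1999/SpecialLefschetzGroupInvariantsPowers` («injectivity of `g ↦ g₁` on `S(A)`»)
left open, and turning the "Identification with the printed groups (not formalised)" paragraph of `Milne1999/LefschetzGroup` into
theorems for `S(A) := Milne1999.specialLefschetzGroup (dim A) A.X` (Künneth families on the powers fixing the Lefschetz classes;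
`S(A)(ℂ) := Milne1999.unitaryCentralizerGroup A h`, Milne's `{γ ∈ C(A) ⊗ ℂ | γ†γ = 1}` read on `H¹`).

* §H1 **`S(A)` ACTS THROUGH `H¹`** (FACT-FREE): `g_k(v₁ ∪ ⋯ ∪ v_k) = g₁v₁ ∪ ⋯ ∪ g₁v_k` (`specialLefschetzGroup_apply_cupPowOne`,
  the companion's van Geemen 6.5 for the Lefschetz system), hence **`g_k = ⋀ᵏ(g₁)`** (`…_toLinearMap_eq_exteriorPullback`,
  `…_eq_exteriorPullbackEquiv`), `g` is multiplicative (`…_map_cupProduct`), and **`g ↦ g₁` is INJECTIVE on `S(A)`**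
  (`specialLefschetzGroup_ext_one`, `…_evalOne_injOn`) — gen 84 had this for `G¹_alg ⊇ G¹_mot ⊇ G¹_AH ⊇ Hg`, not for `S(A)`.
* §H2 **MILNE THM. 4.4 IN FULL ON THE CARRIERS**: for a polarization class `h` (rational, `s · h` Kähler), **`g ↦ g₁` is a BIJECTION
  `S(A) → S(A)(ℂ) = unitaryCentralizerGroup A h`** (`specialLefschetzGroup_evalOne_bijOn`; the lane's record
  `Milne1999_thm44_…_holds` is its image half), with inverse `u ↦ (⋀ᵏu)_k` (`exteriorPullbackEquiv_mem_specialLefschetzGroup_iff`):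
  the tree's Tannaka-free `specialLefschetzGroup` IS Milne's `S(A)` on `ℂ`-points, as a group.
* §H3 **THE KÜNNETH FAMILY of `g ∈ S(A)` is `⋀•(g₁^{⊕(a+1)})`** (`kunnethFamily_eq_exteriorKunnethFamily`, the lane's
  `exteriorKunnethFamily`): `S(A)` acts on `H•(A^{a+1})` diagonally through `H¹(A^{a+1}) = (a+1) H¹(A)`.
* §H4 **COR. 4.7 FOR THE TANNAKA-FREE GROUPS: `S(A^{r+1}) = S(A)` diagonally** (`mem_specialLefschetzGroup_powSucc_iff`, `0 < dim A`):
  an automorphism family `g'` of `H•(A^{r+1}(ℂ); ℂ)` lies in `specialLefschetzGroup (dim A^{r+1}) (A^{r+1}).X` iff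
  `g' = ⋀•(u^{⊕(r+1)})` (`Milne1999.diagPowExterior A u r`) for a (unique) `u ∈ S(A)(ℂ)`; with §H3, equivalently iff `g'` is the
  `r`-th member of the Künneth family of an element of `S(A)`. Inputs: §H1 on `A^{r+1}`, the lane's `C(A^{r+1}) = C(A)` diagonally
  (`exists_eq_diagPow_of_mem_centralizerGroup`), and `⋀²u` fixing `h` forces `u ∈ S(A)(ℂ)`
  (`mem_unitaryCentralizerGroup_of_exteriorPullback_two_eq`, the lane's determinant argument).
* §H5 **subgroups of `S(A)` are determined by their images in `GL(H¹)`** (`specialLefschetzGroup_le_iff_unitaryCentralizerGroup_le_map`):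
  gen 84's §L4 hypothesis «`U(C(A) ⊗ ℂ, †) ≤ G¹_AH(A)|_{H¹}`» ⟺ §L3's «`S(A) ≤ G¹_AH(A)`» (mod c23) ⟺ AH classes on all powers are
  Lefschetz (`…ExteriorPowers`); `G¹_mot(A) = S(A) ⟺ U(C(A) ⊗ ℂ, †) ≤ G¹_mot(A)|_{H¹}` (fact-free).

HONEST COLUMN. No definition, no named fact, no sorry; nothing of the cell is discharged or displayed; V-B3 = c23 is displayed once (§H5, AH form).
For the cell this closes the `S(A)`-side of the `GL(H¹)` dictionary of gens 81/84 (all five groups of the tower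
`Hg ≤ G¹_AH ≤ G¹_mot ≤ G¹_alg ≤ S(A)` now act through `H¹` and inject into `GL(H¹(A(ℂ); ℂ))`, the last with image exactly
`U(C(A) ⊗ ℂ, †)`); nothing deciding the row. NOT here: `L(A)` / the similitude groups (multiplier `γ†γ ≠ 1`); Cor. 4.7 for products of
non-isogenous factors; dimension `0` in §H4. PRESEARCH: Milne 1999 Thm. 4.4, Cor. 4.7 [corpus: paper:doi-10-1215-s0012-7094-99-09620-5
p. 659 (held p0021)]; van Geemen LNM 1594 6.4–6.5; galaxy «Lefschetz group|exterior algebra» → nothing on Künneth-family carriers; assembly,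
no novelty claimed. References (bib keys): Milne1999LefschetzClasses (§1 pp. 643–644, §4 Def. 4.3, Thm. 4.4, Cor. 4.5, Cor. 4.7, §5 Cor.
5.6–5.8), vanGeemen1994HodgeAV (6.4–6.5), LangeBirkenhake1992 (Lemma 1.1.17), HatcherAT2002 (§3.2 Thm. 3.16), Deligne1982HodgeCycles (I §3).
-/

noncomputable section

-- every declaration of this problem lives in `Summit.HodgeConjecture.HodgeConjecture.…` (summit = sub-problem)
set_option linter.dupNamespace false

namespace Summit.HodgeConjecture.HodgeConjecture.Ring2.Hypotheses

open CategoryTheory AlgebraicGeometry MonoidalCategory CartesianMonoidalCategory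
open Literature.AlgebraicGeometry Literature.AlgebraicGeometry.Motives
open Literature.AlgebraicGeometry.HodgeTheory
open Literature.AlgebraicTopology.SingularHomology
open Literature.Barriers.HodgeConjecture
open Literature.Geometry.Kaehler (lefschetzPow)
open Literature.AlgebraicGeometry.Milne1999 (specialLefschetzGroup lefschetzPowClasses unitaryCentralizerGroup centralizerGroup
  diagPow diagPowExterior exteriorKunnethFamily exteriorPullbackEquiv prodBlockDiagEquiv powPolarizationClass)

/-! ## §H1 `S(A)` acts through `H¹`: `g_k = ⋀ᵏ(g₁)`, multiplicativity, injectivity of `g ↦ g₁` -/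

section ThroughH1

variable {A : AbelianVariety ℂ} {g g' : ∀ k : ℕ, complexBetti A.X k ≃ₗ[ℂ] complexBetti A.X k}

/-- **van Geemen 6.5 for Milne's Tannaka-free `S(A)`**: `g_k(v₁ ∪ ⋯ ∪ v_k) = g₁v₁ ∪ ⋯ ∪ g₁v_k` for every
`g ∈ specialLefschetzGroup (dim A) A.X` (its Künneth family fixes only the Lefschetz classes; companion,
`SpecialLefschetzExterior.apply_cupPowOne`). FACT-FREE. [cite: vanGeemen1994HodgeAV, 6.4–6.5] [cite: Milne1999LefschetzClasses, Thm. 4.4 (p. 659)] -/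
theorem specialLefschetzGroup_apply_cupPowOne (hg : g ∈ specialLefschetzGroup A.dim A.X) (k : ℕ)
    (v : Fin k → complexBetti A.X 1) :
    g k (cupPowOne ℂ (ComplexPoints A.X) k v) = cupPowOne ℂ (ComplexPoints A.X) k (fun j ↦ g 1 (v j)) := by
  obtain ⟨G, hG, h0, hfix⟩ := (hg : g ∈ powClassStabilizer A.X (lefschetzPowClasses A.dim A.X))
  exact SpecialLefschetzExterior.apply_cupPowOne hG h0 rfl hfix k v

/-- **`g_k = ⋀ᵏ(g₁)` for `g ∈ S(A)`**: the degree-`k` component IS the exterior pull-back (`HodgeTheory.exteriorPullback`,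
`v₀ ∪ ⋯ ∪ v_{k-1} ↦ g₁v₀ ∪ ⋯ ∪ g₁v_{k-1}`) of the degree-one component — Milne's «natural left action of `GL(V(A))` on
`H^s(A^r) ≅ ⋀ H¹(A^r)`» (p. 658), here a THEOREM about the Tannaka-free group rather than its definition.
[cite: Milne1999LefschetzClasses, §4 p. 658 and Def. 4.3] [cite: vanGeemen1994HodgeAV, 4.8 and 6.5] -/
theorem specialLefschetzGroup_toLinearMap_eq_exteriorPullback (hg : g ∈ specialLefschetzGroup A.dim A.X) (k : ℕ) :
    (g k : complexBetti A.X k →ₗ[ℂ] complexBetti A.X k) =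
      exteriorPullback (AbelianVariety.hasExteriorCohomologyH1_complexPoints A)
        (g 1 : complexBetti A.X 1 →ₗ[ℂ] complexBetti A.X 1) k := by
  refine exteriorPullback_ext (AbelianVariety.hasExteriorCohomologyH1_complexPoints A) fun v ↦ ?_
  rw [LinearEquiv.coe_coe, specialLefschetzGroup_apply_cupPowOne hg, exteriorPullback_cupPowOne]
  rfl

/-- Pointwise form: `g_k x = ⋀ᵏ(g₁) x`. [cite: Milne1999LefschetzClasses, §4 p. 658] -/
theorem specialLefschetzGroup_apply_eq_exteriorPullback (hg : g ∈ specialLefschetzGroup A.dim A.X) (k : ℕ) (x : complexBetti A.X k) :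
    g k x = exteriorPullback (AbelianVariety.hasExteriorCohomologyH1_complexPoints A)
      (g 1 : complexBetti A.X 1 →ₗ[ℂ] complexBetti A.X 1) k x := by
  rw [← specialLefschetzGroup_toLinearMap_eq_exteriorPullback hg k, LinearEquiv.coe_coe]

/-- **`g = (⋀ᵏ(g₁))_k`** as a family of automorphisms (the lane's `exteriorPullbackEquiv`). [cite: Milne1999LefschetzClasses, §4 p. 658 and Thm. 4.4] -/
theorem specialLefschetzGroup_eq_exteriorPullbackEquiv (hg : g ∈ specialLefschetzGroup A.dim A.X) :
    g = fun k ↦ exteriorPullbackEquiv (AbelianVariety.hasExteriorCohomologyH1_complexPoints A) (g 1) k := by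
  funext k
  refine LinearEquiv.toLinearMap_injective ?_
  rw [Milne1999.coe_exteriorPullbackEquiv]
  exact specialLefschetzGroup_toLinearMap_eq_exteriorPullback hg k

/-- **Multiplicativity**: `g (x ∪ y) = g x ∪ g y` for `g ∈ S(A)` (`⋀•(g₁)` is multiplicative, `exteriorPullback_cupProduct`).
[cite: HatcherAT2002, §3.2 Example 3.16] [cite: vanGeemen1994HodgeAV, 6.5] -/
theorem specialLefschetzGroup_map_cupProduct (hg : g ∈ specialLefschetzGroup A.dim A.X) {i j k : ℕ} (h : i + j = k)
    (x : complexBetti A.X i) (y : complexBetti A.X j) : g k (cupProduct h x y) = cupProduct h (g i x) (g j y) := by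
  rw [specialLefschetzGroup_apply_eq_exteriorPullback hg k, specialLefschetzGroup_apply_eq_exteriorPullback hg i,
    specialLefschetzGroup_apply_eq_exteriorPullback hg j, exteriorPullback_cupProduct]

/-- **INJECTIVITY of `g ↦ g₁` on `S(A)`**: two elements of the Tannaka-free special Lefschetz group with the same `H¹`-component are
equal. [cite: Milne1999LefschetzClasses, Thm. 4.4 (p. 659)] [cite: vanGeemen1994HodgeAV, 6.4–6.5] -/
theorem specialLefschetzGroup_ext_one (hg : g ∈ specialLefschetzGroup A.dim A.X) (hg' : g' ∈ specialLefschetzGroup A.dim A.X)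
    (h1 : g 1 = g' 1) : g = g' := by
  rw [specialLefschetzGroup_eq_exteriorPullbackEquiv hg, specialLefschetzGroup_eq_exteriorPullbackEquiv hg', h1]

/-- **`S(A) ↪ GL(H¹(A(ℂ); ℂ))`**: `g ↦ g₁` (`Pi.evalMonoidHom _ 1`) is injective on `S(A)`. [cite: Milne1999LefschetzClasses, Thm. 4.4 (p. 659)] -/
theorem specialLefschetzGroup_evalOne_injOn :
    Set.InjOn (Pi.evalMonoidHom (fun k : ℕ ↦ complexBetti A.X k ≃ₗ[ℂ] complexBetti A.X k) 1)
      (specialLefschetzGroup A.dim A.X : Set (∀ k : ℕ, complexBetti A.X k ≃ₗ[ℂ] complexBetti A.X k)) :=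
  fun _ hg _ hg' h1 ↦ specialLefschetzGroup_ext_one hg hg' h1

end ThroughH1

/-! ## §H2 Milne Thm. 4.4 in full on the carriers: `g ↦ g₁` is a bijection `S(A) → U(C(A) ⊗ ℂ, †)` -/

section Thm44

variable (A : AbelianVariety ℂ) {h : complexBetti A.X 2}

/-- **MILNE 1999, THM. 4.4 ON `ℂ`-POINTS, TANNAKA-FREE AND IN FULL**: for a polarization class `h` (rational, `s · h` Kähler for a
real `s > 0`), restriction to `H¹` is a BIJECTION from the tree's special Lefschetz group `specialLefschetzGroup (dim A) A.X`
(Künneth families fixing the Lefschetz classes on all powers — Milne's Def. 4.3 of `L(A)`, kernel of `l`) onto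
`unitaryCentralizerGroup A h = {u ∈ (C(A) ⊗ ℂ)^× | Q_h(ux, uy) = Q_h(x, y)}` (Milne's `S(A)(ℂ)`, §1 p. 644): «The theorem shows that
the kernel of `l(A)`, regarded as a subgroup of `GL(V(A))`, equals `S(A)`». Image = the lane's discharged record
`Milne1999_thm44_specialLefschetzGroup_one_eq_unitaryCentralizerGroup_holds`; injectivity = §H1.
[cite: Milne1999LefschetzClasses, Thm. 4.4 and p. 659 (`ker l(A) = S(A)`), §1 p. 644] -/
theorem specialLefschetzGroup_evalOne_bijOn (hQ : IsRationalClass h) (hK : ∃ s : ℝ, 0 < s ∧ IsKaehlerClass A.dim A.X ((s : ℂ) • h)) :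
    Set.BijOn (Pi.evalMonoidHom (fun k : ℕ ↦ complexBetti A.X k ≃ₗ[ℂ] complexBetti A.X k) 1)
      (specialLefschetzGroup A.dim A.X : Set (∀ k : ℕ, complexBetti A.X k ≃ₗ[ℂ] complexBetti A.X k))
      (unitaryCentralizerGroup A h : Set (complexBetti A.X 1 ≃ₗ[ℂ] complexBetti A.X 1)) := by
  have hrec := Milne1999.Milne1999_thm44_specialLefschetzGroup_one_eq_unitaryCentralizerGroup_holds A h hQ hK
  refine ⟨fun g hg ↦ ?_, specialLefschetzGroup_evalOne_injOn, fun u hu ↦ ?_⟩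
  · have hmem := Subgroup.mem_map_of_mem (Pi.evalMonoidHom (fun k : ℕ ↦ complexBetti A.X k ≃ₗ[ℂ] complexBetti A.X k) 1) hg
    rw [hrec] at hmem
    exact hmem
  · have hu' : u ∈ (specialLefschetzGroup A.dim A.X).map
        (Pi.evalMonoidHom (fun k : ℕ ↦ complexBetti A.X k ≃ₗ[ℂ] complexBetti A.X k) 1) := by
      rw [hrec]; exact hu
    obtain ⟨g, hg, hgu⟩ := Subgroup.mem_map.1 hu'
    exact ⟨g, hg, hgu⟩

/-- **The inverse `u ↦ (⋀ᵏu)_k`**: `(⋀ᵏu)_k ∈ S(A)` iff `u ∈ S(A)(ℂ)` (`⟸` the lane's Thm. 4.4 `⊇`; `⟹` evaluate at `k = 1`).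
[cite: Milne1999LefschetzClasses, Thm. 4.4 (p. 659)] -/
theorem exteriorPullbackEquiv_mem_specialLefschetzGroup_iff (hQ : IsRationalClass h)
    (hK : ∃ s : ℝ, 0 < s ∧ IsKaehlerClass A.dim A.X ((s : ℂ) • h)) (u : complexBetti A.X 1 ≃ₗ[ℂ] complexBetti A.X 1) :
    (fun k ↦ exteriorPullbackEquiv (AbelianVariety.hasExteriorCohomologyH1_complexPoints A) u k) ∈ specialLefschetzGroup A.dim A.X ↔
      u ∈ unitaryCentralizerGroup A h := by
  constructor
  · intro hg
    have h1 := (specialLefschetzGroup_evalOne_bijOn A hQ hK).1 hg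
    rwa [Pi.evalMonoidHom_apply, Milne1999.exteriorPullbackEquiv_one_eq] at h1
  · intro hu
    obtain ⟨g, hg, hgu⟩ := Subgroup.mem_map.1 (Milne1999.unitaryCentralizerGroup_le_specialLefschetzGroup_map_one hQ hK hu)
    rw [Pi.evalMonoidHom_apply] at hgu
    rw [← hgu, ← specialLefschetzGroup_eq_exteriorPullbackEquiv hg]
    exact hg

end Thm44

/-! ## §H3 The Künneth family of `g ∈ S(A)` is `⋀•(g₁^{⊕(a+1)})` -/

section Kunneth

variable {A : AbelianVariety ℂ} {g : ∀ k : ℕ, complexBetti A.X k ≃ₗ[ℂ] complexBetti A.X k}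

/-- **`S(A)` acts on the powers diagonally through `H¹`**: the (unique) Künneth family of `g ∈ S(A)` is the lane's
`exteriorKunnethFamily A (g 1)` — on `A.X^{×(a+1)} = (A^{a+1}).X` it is `⋀•(g₁^{⊕(a+1)})`, the action of `γ = g₁ ∈ GL(V(A))` on
`H•(A^{a+1}) = ⋀•((a+1) H¹(A))` through which Milne's `L(A)` is DEFINED to act (Def. 4.3); uniqueness of Künneth families
(`IsKunnethFamily.ext_of_apply_zero`) and §H1. [cite: Milne1999LefschetzClasses, Def. 4.3 and §4 p. 658] [cite: HatcherAT2002, §3.2 Thm. 3.16] -/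
theorem kunnethFamily_eq_exteriorKunnethFamily (hg : g ∈ specialLefschetzGroup A.dim A.X)
    {G : ∀ a k : ℕ, complexBetti (cartesianPow A.X (a + 1)) k ≃ₗ[ℂ] complexBetti (cartesianPow A.X (a + 1)) k}
    (hG : IsKunnethFamily A.X G) (h0 : G 0 = g) : G = exteriorKunnethFamily A (g 1) :=
  IsKunnethFamily.ext_of_apply_zero AbelianVariety.isSmoothProjective_holds hG
    (Milne1999.isKunnethFamily_exteriorKunnethFamily A (g 1))
    (h0.trans ((specialLefschetzGroup_eq_exteriorPullbackEquiv hg).trans (Milne1999.exteriorKunnethFamily_zero A (g 1)).symm))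

/-- `⋀•(g₁^{⊕(a+1)})` fixes every Lefschetz class of every power, for `g ∈ S(A)`. [cite: Milne1999LefschetzClasses, Thm. 4.4 (proof, p. 659)] -/
theorem exteriorKunnethFamily_apply_eq_self_of_mem_specialLefschetzGroup (hg : g ∈ specialLefschetzGroup A.dim A.X) (a p : ℕ)
    {c : complexBetti (cartesianPow A.X (a + 1)) (2 * p)} (hc : c ∈ lefschetzPowClasses A.dim A.X a p) :
    exteriorKunnethFamily A (g 1) a (2 * p) c = c := by
  have hg' : g ∈ powClassStabilizer A.X (lefschetzPowClasses A.dim A.X) := hg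
  obtain ⟨G, hG, h0, hfix⟩ := hg'
  rw [← kunnethFamily_eq_exteriorKunnethFamily hg hG h0]
  exact hfix a p c hc

end Kunneth

/-! ## §H4 Cor. 4.7 for the Tannaka-free groups: `S(A^{r+1}) = S(A)` diagonally -/

section Cor47

variable {A : AbelianVariety ℂ} {h : complexBetti A.X 2}

/-- `B¹(X) ⊗ ℂ ⊆ D¹_hom(X)_ℂ` (the span of the rational `(1,1)`-classes lies in the span of the divisor monomials). [cite: vanGeemen1994HodgeAV, §2.4] -/
theorem hodgeClassSpan_one_le_divisorClassesSpan {n : ℕ} {X : SchemeOver ℂ} :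
    VanGeemen1994.hodgeClassSpan n X 1 ≤ divisorClassesSpan X n 1 :=
  Submodule.span_le.2 fun _ hc ↦ mem_divisorClassesSpan_one hc.1 hc.2

/-- **`⋀²u` fixes the polarization class when `⋀•(u^{⊕(r+1)}) ∈ S(A^{r+1})`**: for `h ∈ B¹(A) ⊗ ℂ`, the divisor class
`pr_{r+1}^* h` of `A^{r+1}` is fixed by the degree-`2` component `⋀²(u^{⊕(r+1)})`, which acts on it as `pr_{r+1}^*(⋀²u h)`
(`exteriorPullback_prodBlockDiagEquiv_map_snd`), and `pr_{r+1}^*` is injective (it has the section `(0, 𝟙)`).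
[cite: Milne1999LefschetzClasses, §1 p. 643 and Thm. 4.4 (proof, p. 659)] -/
theorem exteriorPullback_two_eq_self_of_diagPowExterior_mem (hh : h ∈ VanGeemen1994.hodgeClassSpan A.dim A.X 1)
    {u : complexBetti A.X 1 ≃ₗ[ℂ] complexBetti A.X 1} :
    ∀ r : ℕ, diagPowExterior A u r ∈ specialLefschetzGroup (A.powSucc r).dim (A.powSucc r).X →
      exteriorPullback (AbelianVariety.hasExteriorCohomologyH1_complexPoints A)
        (u : complexBetti A.X 1 →ₗ[ℂ] complexBetti A.X 1) 2 h = h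
  | 0, hg => by
    have e := Milne1999.apply_eq_self_of_mem_specialLefschetzGroup hg (p := 1) (hodgeClassSpan_one_le_divisorClassesSpan hh)
    rwa [Milne1999.diagPowExterior, Milne1999.exteriorPullbackEquiv_apply] at e
  | r + 1, hg => by
    -- the divisor class `pr^* h` of `A^{r+2} = A^{r+1} × A` is fixed by `⋀²(u^{⊕(r+1)} ⊕ u)`
    set c : complexBetti ((A.powSucc r).prod A).X 2 := complexBetti.map (AbelianVariety.snd (A.powSucc r) A).hom.hom.hom 2 h with hc
    have hcmem : c ∈ divisorClassesSpan (A.powSucc (r + 1)).X (A.powSucc (r + 1)).dim 1 :=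
      hodgeClassSpan_one_le_divisorClassesSpan (Milne1999.map_mem_hodgeClassSpan_one (AbelianVariety.snd (A.powSucc r) A) hh)
    have e := Milne1999.apply_eq_self_of_mem_specialLefschetzGroup hg (p := 1) hcmem
    rw [Milne1999.diagPowExterior, Milne1999.exteriorPullbackEquiv_apply] at e
    -- `⋀²(u^{⊕(r+1)} ⊕ u) (pr^* h) = pr^* (⋀²u h)`
    have e' : complexBetti.map (AbelianVariety.snd (A.powSucc r) A).hom.hom.hom 2
        (exteriorPullback (AbelianVariety.hasExteriorCohomologyH1_complexPoints A)
          (u : complexBetti A.X 1 →ₗ[ℂ] complexBetti A.X 1) 2 h) = c :=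
      (Milne1999.exteriorPullback_prodBlockDiagEquiv_map_snd (diagPow A u r) u 2 h).symm.trans e
    -- `pr^*` is injective: apply the section `(0, 𝟙) : A → A^{r+1} × A`
    have hsec : ∀ z : complexBetti A.X 2, complexBetti.map (AbelianVariety.prodLift (0 : A ⟶ A.powSucc r) (𝟙 A)).hom.hom.hom 2
        (complexBetti.map (AbelianVariety.snd (A.powSucc r) A).hom.hom.hom 2 z) = z := by
      intro z
      rw [← Milne1999.complexBetti_map_comp_apply, AbelianVariety.prodLift_snd]
      change complexBetti.map (𝟙 A.X) 2 z = z
      rw [complexBetti.map_id]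
      rfl
    have e'' := congrArg (complexBetti.map (AbelianVariety.prodLift (0 : A ⟶ A.powSucc r) (𝟙 A)).hom.hom.hom 2) e'
    rwa [hsec, hc, hsec] at e''

/-- **An element of `(C(A) ⊗ ℂ)^×` whose `⋀²` fixes the polarization class lies in `S(A)(ℂ)`** (the lane's determinant argument, proof
of Thm. 4.4 on `H¹`: `⋀²u h = h` gives `⋀•u hⁿ = hⁿ ≠ 0`, so `det u = 1`, so `Q_h(ux, uy) = ⋀^{2n}u (h^{n-1} ∪ x ∪ y) = Q_h(x, y)`).
[cite: Milne1999LefschetzClasses, Thm. 4.4 and p. 659, §1 p. 644] [cite: LangeBirkenhake1992, Lemma 1.1.17] -/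
theorem mem_unitaryCentralizerGroup_of_exteriorPullback_two_eq
    (hK : ∃ s : ℝ, 0 < s ∧ IsKaehlerClass A.dim A.X ((s : ℂ) • h)) {u : complexBetti A.X 1 ≃ₗ[ℂ] complexBetti A.X 1}
    (hu : u ∈ centralizerGroup A)
    (hU2 : exteriorPullback (AbelianVariety.hasExteriorCohomologyH1_complexPoints A)
      (u : complexBetti A.X 1 →ₗ[ℂ] complexBetti A.X 1) 2 h = h) :
    u ∈ unitaryCentralizerGroup A h := by
  haveI : Module.Finite ℂ (complexBetti A.X 1) := abelianVarietyCohomologyExteriorH1_holds.finite_one A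
  obtain ⟨s, hs, hKs⟩ := hK
  refine ⟨hu, fun x y ↦ ?_⟩
  rcases Nat.eq_zero_or_pos A.dim with hA | hn
  · have hV : Module.finrank ℂ (complexBetti A.X 1) = 0 := by
      rw [AbelianVariety.finrank_complexBetti_one, hA, mul_zero]
    haveI : Subsingleton (complexBetti A.X 1) := Module.finrank_zero_iff.1 hV
    rw [Subsingleton.elim (u x) x, Subsingleton.elim (u y) y]
  have hX : IsSmoothProjective A.dim A.X := AbelianVariety.isSmoothProjective_holds (A := A)
  have hΛ := AbelianVariety.hasExteriorCohomologyH1_complexPoints A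
  have hpow : cupPowTwo h A.dim ≠ 0 := by
    intro h0
    have e := hKs.cupPowTwo_ne_zero hX (p := A.dim) hn le_rfl
    rw [cupPowTwo_smul, h0, smul_zero] at e
    exact e rfl
  have hdet : LinearMap.det (u : complexBetti A.X 1 →ₗ[ℂ] complexBetti A.X 1) = 1 := by
    have e := Milne1999.exteriorPullback_cupPowTwo hΛ hU2 A.dim
    rw [Milne1999.exteriorPullback_top hΛ _ (AbelianVariety.finrank_complexBetti_one A)] at e
    exact smul_left_injective ℂ hpow (e.trans (one_smul ℂ _).symm)
  have hxy : cupProduct (rfl : 1 + 1 = 2) (u x) (u y) =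
      exteriorPullback hΛ (u : complexBetti A.X 1 →ₗ[ℂ] complexBetti A.X 1) 2 (cupProduct (rfl : 1 + 1 = 2) x y) := by
    rw [Milne1999.exteriorPullback_cupProduct_one_one]
    rfl
  rw [polarizationPairingOne_apply, polarizationPairingOne_apply, hxy,
    ← Milne1999.exteriorPullback_lefschetzPow hΛ hU2 2 _ (A.dim - 1),
    Milne1999.exteriorPullback_top hΛ _ (d := 2 + 2 * (A.dim - 1))
      (by rw [AbelianVariety.finrank_complexBetti_one]; omega), hdet, one_smul]

variable (A) in
/-- **MILNE COR. 4.7 FOR THE TANNAKA-FREE GROUPS — `S(A^{r+1}) = S(A)` DIAGONALLY** (`0 < dim A`, `h` a polarization class of `A`):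
a family `g'` of automorphisms of the `Hᵏ(A^{r+1}(ℂ); ℂ)` lies in the special Lefschetz group OF THE POWER,
`specialLefschetzGroup (dim A^{r+1}) (A^{r+1}).X`, iff `g' = ⋀•(u^{⊕(r+1)})` (`Milne1999.diagPowExterior A u r`) for some (unique,
`diagPow_injective`) `u ∈ S(A)(ℂ) = unitaryCentralizerGroup A h`. `⟸`: the lane's Thm. 4.4 `⊇` on `A^{r+1}` for the product polarization
`Σᵢ prᵢ^* h`; `⟹`: `g'` acts through `H¹(A^{r+1})` (§H1 there), `g'₁ ∈ C(A^{r+1}) = C(A)^{diag}` (`specialLefschetzGroup_map_one_le_centralizerGroup`,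
`exists_eq_diagPow_of_mem_centralizerGroup`), and the two previous theorems. [cite: Milne1999LefschetzClasses, Cor. 4.7 (p. 659), §1 p. 643, Thm. 4.4] -/
theorem mem_specialLefschetzGroup_powSucc_iff (hA0 : 0 < A.dim) (hQ : IsRationalClass h)
    (hK : ∃ s : ℝ, 0 < s ∧ IsKaehlerClass A.dim A.X ((s : ℂ) • h)) (r : ℕ)
    (g' : ∀ k : ℕ, complexBetti (A.powSucc r).X k ≃ₗ[ℂ] complexBetti (A.powSucc r).X k) :
    g' ∈ specialLefschetzGroup (A.powSucc r).dim (A.powSucc r).X ↔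
      ∃ u ∈ unitaryCentralizerGroup A h, g' = diagPowExterior A u r := by
  obtain ⟨s, hs, hKs⟩ := id hK
  have hh : h ∈ VanGeemen1994.hodgeClassSpan A.dim A.X 1 := Milne1999.mem_hodgeClassSpan_one_of_isKaehlerClass_smul hQ hs.ne' hKs
  have htop : lefschetzPow h (A.dim - 1) 2 h ≠ 0 := Milne1999.lefschetzPow_self_ne_zero_of_isKaehlerClass_smul hA0 hKs
  have hnd := Milne1999.eq_zero_of_forall_polarizationPairingOne_eq_zero_of_isKaehlerClass_smul' hs.ne' hKs
  constructor
  · intro hg'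
    -- `g'₁ ∈ C(A^{r+1}) = C(A)` diagonally
    have h1 : g' 1 ∈ centralizerGroup (A.powSucc r) :=
      Milne1999.specialLefschetzGroup_map_one_le_centralizerGroup (A.powSucc r) (Subgroup.mem_map_of_mem _ hg')
    obtain ⟨u, hu, huU⟩ := Milne1999.exists_eq_diagPow_of_mem_centralizerGroup r (g' 1) h1
    -- `g'` acts through `H¹(A^{r+1})`: `g' = ⋀•(g'₁) = ⋀•(u^{⊕(r+1)})`
    have hg'eq : g' = diagPowExterior A u r := by
      rw [specialLefschetzGroup_eq_exteriorPullbackEquiv hg', ← huU]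
      rfl
    refine ⟨u, mem_unitaryCentralizerGroup_of_exteriorPullback_two_eq hK hu ?_, hg'eq⟩
    exact exteriorPullback_two_eq_self_of_diagPowExterior_mem hh r (hg'eq ▸ hg')
  · rintro ⟨u, hu, rfl⟩
    exact Milne1999.exteriorPullbackEquiv_mem_specialLefschetzGroup (Milne1999.dim_powSucc_pos hA0 r)
      (Milne1999.powPolarizationClass_mem_hodgeClassSpan hh r)
      (Milne1999.lefschetzPow_powPolarizationClass_self_ne_zero hA0 htop r)
      (Milne1999.eq_zero_of_forall_polarizationPairingOne_powPolarizationClass_eq_zero hA0 htop hnd r)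
      (Milne1999.diagPow_mem_unitaryCentralizerGroup hA0 hu r)

variable (A) in
/-- **Cor. 4.7, Künneth form: every element of `S(A^{r+1})` is the `r`-th member of the Künneth family of a unique element of
`S(A)`** — `S(A)` acting diagonally on the powers exhausts the special Lefschetz groups of the powers (`0 < dim A`; the `r`-th member
of the family of `g ∈ S(A)` is `⋀•(g₁^{⊕(r+1)})` read on `A.X^{×(r+1)} = (A^{r+1}).X`, §H3 and the lane's `exteriorKunnethFamily`).
[cite: Milne1999LefschetzClasses, Cor. 4.7 (p. 659) and Def. 4.3] -/
theorem exists_mem_specialLefschetzGroup_diagPowExterior_eq (hA0 : 0 < A.dim) (r : ℕ)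
    {g' : ∀ k : ℕ, complexBetti (A.powSucc r).X k ≃ₗ[ℂ] complexBetti (A.powSucc r).X k}
    (hg' : g' ∈ specialLefschetzGroup (A.powSucc r).dim (A.powSucc r).X) :
    ∃ g ∈ specialLefschetzGroup A.dim A.X, diagPowExterior A (g 1) r = g' := by
  obtain ⟨D⟩ := nonempty_kaehlerRationalDatum (AbelianVariety.isSmoothProjective_holds (A := A))
  have hK : ∃ s : ℝ, 0 < s ∧ IsKaehlerClass A.dim A.X ((s : ℂ) • D.Hη) :=
    ⟨1, one_pos, by
      rw [Complex.ofReal_one, one_smul]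
      exact D.isKaehlerClassVia.isKaehlerClass D.isNatural D.isMultiplicative⟩
  obtain ⟨u, hu, rfl⟩ := (mem_specialLefschetzGroup_powSucc_iff A hA0 D.isRationalClass_Hη hK r g').1 hg'
  refine ⟨fun k ↦ exteriorPullbackEquiv (AbelianVariety.hasExteriorCohomologyH1_complexPoints A) u k,
    (exteriorPullbackEquiv_mem_specialLefschetzGroup_iff A D.isRationalClass_Hη hK u).2 hu, ?_⟩
  dsimp only
  rw [Milne1999.exteriorPullbackEquiv_one_eq]

end Cor47

/-! ## §H5 Subgroups of `S(A)` are determined by their images in `GL(H¹)`: gen 84's §L4 hypothesis ⟺ §L3's -/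

section Images

variable (A : AbelianVariety ℂ) {h : complexBetti A.X 2}

/-- **For `K ≤ S(A)`: `S(A) ≤ K` iff `S(A)(ℂ) = U(C(A) ⊗ ℂ, †_h) ≤ K|_{H¹}` in `GL(H¹(A(ℂ); ℂ))`** (`h` a polarization class) — both
groups inject into `GL(H¹)` (§H1) and `S(A)|_{H¹} = U(C(A) ⊗ ℂ, †_h)` (§H2). [cite: Milne1999LefschetzClasses, Thm. 4.4 (p. 659)] -/
theorem specialLefschetzGroup_le_iff_unitaryCentralizerGroup_le_map (hQ : IsRationalClass h)
    (hK : ∃ s : ℝ, 0 < s ∧ IsKaehlerClass A.dim A.X ((s : ℂ) • h))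
    {K : Subgroup (∀ k : ℕ, complexBetti A.X k ≃ₗ[ℂ] complexBetti A.X k)} (hKS : K ≤ specialLefschetzGroup A.dim A.X) :
    specialLefschetzGroup A.dim A.X ≤ K ↔
      unitaryCentralizerGroup A h ≤ K.map (Pi.evalMonoidHom (fun k : ℕ ↦ complexBetti A.X k ≃ₗ[ℂ] complexBetti A.X k) 1) := by
  constructor
  · intro hSK u hu
    obtain ⟨g, hg, hgu⟩ := (specialLefschetzGroup_evalOne_bijOn A hQ hK).2.2 hu
    exact Subgroup.mem_map.2 ⟨g, hSK hg, hgu⟩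
  · intro hUK g hg
    have hg1 : g 1 ∈ unitaryCentralizerGroup A h := (specialLefschetzGroup_evalOne_bijOn A hQ hK).1 hg
    obtain ⟨k, hk, hk1⟩ := Subgroup.mem_map.1 (hUK hg1)
    rw [Pi.evalMonoidHom_apply] at hk1
    rwa [specialLefschetzGroup_ext_one hg (hKS hk) hk1.symm]

/-- **`G¹_mot(A) = S(A)` ⟺ `U(C(A) ⊗ ℂ, †_h) ≤ G¹_mot(A)|_{H¹}`** — FACT-FREE (`G¹_mot ≤ S`, `…ExteriorPowers`); with
`specialMotivatedGaloisGroup_eq_specialLefschetzGroup_iff` there: ⟺ every motivated class on every power of `A` is Lefschetz.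
[cite: Milne1999LefschetzClasses, Thm. 4.4 and Prop. 4.8] [cite: Andre1996Motifs, §4.6 (ii) (p. 24)] -/
theorem specialMotivatedGaloisGroup_eq_specialLefschetzGroup_iff_unitaryCentralizerGroup_le (hQ : IsRationalClass h)
    (hK : ∃ s : ℝ, 0 < s ∧ IsKaehlerClass A.dim A.X ((s : ℂ) • h)) :
    specialMotivatedGaloisGroup A.dim A.X = specialLefschetzGroup A.dim A.X ↔
      unitaryCentralizerGroup A h ≤ (specialMotivatedGaloisGroup A.dim A.X).map
        (Pi.evalMonoidHom (fun k : ℕ ↦ complexBetti A.X k ≃ₗ[ℂ] complexBetti A.X k) 1) := by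
  rw [← specialLefschetzGroup_le_iff_unitaryCentralizerGroup_le_map A hQ hK (specialMotivatedGaloisGroup_le_specialLefschetzGroup A)]
  exact ⟨fun e ↦ e.ge, fun e ↦ le_antisymm (specialMotivatedGaloisGroup_le_specialLefschetzGroup A) e⟩

/-- **Gen 84's §L4 hypothesis ⟺ §L3's** (mod V-B3 = c23 for `G¹_AH ≤ S(A)`): `U(C(A) ⊗ ℂ, †_h) ≤ G¹_AH(A)|_{H¹}` iff
`S(A) ≤ G¹_AH(A)` — iff (by `…ExteriorPowers`) every absolute Hodge class on every power of `A` is a Lefschetz class.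
[cite: Milne1999LefschetzClasses, Thm. 4.4 and Cor. 4.5] [cite: Deligne1982HodgeCycles, §2 Example 2.1 (a) and I §3 Thm. 3.8] -/
theorem specialLefschetzGroup_le_absoluteHodgeStabilizer_iff_unitaryCentralizerGroup_le (hZ : deligne1982_cycleClass_absoluteHodge)
    (hQ : IsRationalClass h) (hK : ∃ s : ℝ, 0 < s ∧ IsKaehlerClass A.dim A.X ((s : ℂ) • h)) :
    specialLefschetzGroup A.dim A.X ≤ powClassStabilizer A.X (fun a p ↦
      {c : complexBetti (cartesianPow A.X (a + 1)) (2 * p) |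
        IsAbsoluteHodgeClass (cartesianPowDim A.dim a) (cartesianPow A.X (a + 1)) p c}) ↔
      unitaryCentralizerGroup A h ≤ (powClassStabilizer A.X (fun a p ↦
        {c : complexBetti (cartesianPow A.X (a + 1)) (2 * p) |
          IsAbsoluteHodgeClass (cartesianPowDim A.dim a) (cartesianPow A.X (a + 1)) p c})).map
        (Pi.evalMonoidHom (fun k : ℕ ↦ complexBetti A.X k ≃ₗ[ℂ] complexBetti A.X k) 1) :=
  specialLefschetzGroup_le_iff_unitaryCentralizerGroup_le_map A hQ hK
    ((absoluteHodgeStabilizer_le_algebraicStabilizer hZ AbelianVariety.isSmoothProjective_holds).trans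
      (algebraicStabilizer_le_specialLefschetzGroup A))

end Images

end Summit.HodgeConjecture.HodgeConjecture.Ring2.Hypotheses

end
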